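import Literature.MathematicalPhysics.QuantumLattice.IsotropicPropagatorSupBound
import Literature.MathematicalPhysics.QuantumLattice.SectorPropagatorFourier
import HarnessLib

/-!
# Isotropic sector propagators: Fourier form, the isotropic chart and the decay transfer
(Benfatto–Giuliani–Mastropietro 2006, Lemma 2.3 (2.60): first half)

Topic `Literature/MathematicalPhysics/QuantumLattice`; the isotropic companion of
`SectorPropagatorFourier.lean`, for the two-index propagators of `IsotropicPropagatorSupBound`.
BGM 2006, before Lemma 2.3: the isotropic propagators satisfy "the analogue of Lemma 2.2 and of
Lemma 2.2a (to be proven via a repetition of the proof of Lemma 2.2 and Lemma 2.2a)", with the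
ISOTROPIC rescaling `k = p_F(θ̄) + k'`, `k' = O(γ^h)` (2.58): all three directions scale like
`γ^h = 4^{-n}`. PROVED here:

* `genPropagator_eq_fourier` — `g = 𝓕(genSymbolE)(ξ(x₀, x⃗))` for every `(n, m)`;
* `isoChart θ₀ n : ℝ³ ≃L ℝ³`, `t ↦ (4^{-n}t₀, 4^{-n}(t₁ n(θ₀) + t₂ τ(θ₀)))`, `det = (4^{-n})³`, its
  adjoint `isoChartAdj` (`w ↦ 4^{-n}(w₀, ⟨n,w⃗⟩, ⟨τ,w⃗⟩)`);
* `rescaledIsoSymbol` — `R̄(t) = isoSymbolE(q_F + isoChart t)` at `θ̄ = θ_{2n,ω̄}`;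
* **`norm_isoPropagator_le_of_fourier_decay`** — if `‖𝓕R̄(y)‖ ≤ K(1+‖y‖)^{-N}` then
  `|ḡ^{(-n)}_ω̄(x₀,x⃗)| ≤ (4^{-n})³ K (1 + ‖isoChartAdj(ξ)‖)^{-N}`: with `K = O(4ⁿ)` this is (2.60),
  `C_N γ^{2h}/(1 + (γ^h|x₀| + γ^h|x⃗|))^N`.

Everything is PROVED; the definitions are `genSymbolE`, the chart data and `rescaledIsoSymbol`.

## Sources

* G. Benfatto, A. Giuliani, V. Mastropietro, Ann. Henri Poincaré 7 (2006) 809–898, §2.5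
  (2.58)–(2.60), Lemma 2.3 (arXiv:cond-mat/0507686 pp. 11–12). [BenfattoGiulianiMastropietro2006]
-/

noncomputable section

open Real Set MeasureTheory Complex
open scoped Topology ENNReal FourierTransform InnerProductSpace

namespace Literature.MathematicalPhysics.QuantumLattice

/-! ### Fourier form of the two-index propagators -/

/-- The two-index symbol on `ℝ³`. [cite: BenfattoGiulianiMastropietro2006, §2.5 (2.59)] -/
def genSymbolE (e₀ μ : ℝ) (n m : ℕ) (ω : ℤ) : MomSpace → ℂ := fun q => genSymbol e₀ μ n m ω (splitMomentum q)

/-- **The two-index propagator is a Fourier transform**: `g(x₀, x⃗) = 𝓕(genSymbolE)(ξ(x₀, x⃗))`. [cite: BenfattoGiulianiMastropietro2006, §2.5 (2.59)] -/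
theorem genPropagator_eq_fourier (e₀ μ : ℝ) (n m : ℕ) (ω : ℤ) (x₀ : ℝ) (x : Fin 2 → ℝ) :
    genPropagator e₀ μ n m ω x₀ x = 𝓕 (genSymbolE e₀ μ n m ω) (dualPoint x₀ x) := by
  rw [Real.fourier_eq', genPropagator,
    ← measurePreserving_splitMomentum.integral_comp splitMomentum.measurableEmbedding]
  refine integral_congr_ae (ae_of_all _ fun q => ?_)
  simp only [splitMomentum_apply, genSymbolE, smul_eq_mul, Matrix.cons_val_zero, Matrix.cons_val_one]
  congr 2
  rw [inner_E3]
  simp only [dualPoint, PiLp.toLp_apply, Matrix.cons_val_zero, Matrix.cons_val_one, Matrix.cons_val_two,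
    Matrix.tail_cons, Matrix.head_cons]
  push_cast
  field_simp
  ring

/-! ### The isotropic chart -/

section Chart

variable {μ : ℝ} (hμ₁ : -4 < μ) (hμ₂ : μ < -2 - Real.sqrt 2)
include hμ₁ hμ₂

omit hμ₁ hμ₂ in
/-- The matrix of the isotropic chart `t ↦ (4^{-n}t₀, 4^{-n}(t₁ n(θ₀) + t₂ τ(θ₀)))`. [cite: BenfattoGiulianiMastropietro2006, §2.5 (2.58)] -/
def isoChartMatrix (μ θ₀ : ℝ) (n : ℕ) : Matrix (Fin 3) (Fin 3) ℝ :=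
  !![(4 : ℝ) ^ (-(n : ℤ)), 0, 0;
     0, (4 : ℝ) ^ (-(n : ℤ)) * fermiNormal μ θ₀ 0, (4 : ℝ) ^ (-(n : ℤ)) * fermiTangent μ θ₀ 0;
     0, (4 : ℝ) ^ (-(n : ℤ)) * fermiNormal μ θ₀ 1, (4 : ℝ) ^ (-(n : ℤ)) * fermiTangent μ θ₀ 1]

/-- `det = (4^{-n})³`. [cite: BenfattoGiulianiMastropietro2006, §2.5 (2.58)] -/
theorem det_isoChartMatrix (θ₀ : ℝ) (n : ℕ) :
    (isoChartMatrix μ θ₀ n).det = (4 : ℝ) ^ (-(n : ℤ)) * (4 : ℝ) ^ (-(n : ℤ)) * (4 : ℝ) ^ (-(n : ℤ)) := by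
  have hframe := det_fermiFrameMatrix hμ₁ hμ₂ θ₀
  rw [fermiFrameMatrix, Matrix.det_fin_two_of] at hframe
  rw [isoChartMatrix, Matrix.det_fin_three]
  simp only [Matrix.of_apply, Matrix.cons_val', Matrix.cons_val_zero, Matrix.cons_val_one,
    Matrix.cons_val_two, Matrix.empty_val', Matrix.cons_val_fin_one, Matrix.head_cons, Matrix.tail_cons,
    Matrix.head_fin_const]
  linear_combination ((4 : ℝ) ^ (-(n : ℤ)) * (4 : ℝ) ^ (-(n : ℤ)) * (4 : ℝ) ^ (-(n : ℤ))) * hframe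

omit hμ₁ hμ₂ in
/-- The chart as a linear map of `ℝ³`. [folklore] -/
def isoChartLin (μ θ₀ : ℝ) (n : ℕ) : MomSpace →ₗ[ℝ] MomSpace := Matrix.toEuclideanLin (isoChartMatrix μ θ₀ n)

/-- Its determinant. [folklore] -/
theorem det_isoChartLin (θ₀ : ℝ) (n : ℕ) :
    LinearMap.det (isoChartLin μ θ₀ n) = (4 : ℝ) ^ (-(n : ℤ)) * (4 : ℝ) ^ (-(n : ℤ)) * (4 : ℝ) ^ (-(n : ℤ)) := by
  rw [isoChartLin, Matrix.toEuclideanLin, ← det_isoChartMatrix hμ₁ hμ₂ θ₀ n]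
  exact LinearMap.det_toLpLin 2 _

/-- The determinant is nonzero. [folklore] -/
theorem det_isoChartLin_ne_zero (θ₀ : ℝ) (n : ℕ) : LinearMap.det (isoChartLin μ θ₀ n) ≠ 0 := by
  rw [det_isoChartLin hμ₁ hμ₂]; positivity

/-- **The isotropic chart** as a continuous linear automorphism of `ℝ³`. [cite: BenfattoGiulianiMastropietro2006, §2.5 (2.58)] -/
def isoChart (θ₀ : ℝ) (n : ℕ) : MomSpace ≃L[ℝ] MomSpace :=
  (LinearMap.equivOfDetNeZero (isoChartLin μ θ₀ n) (det_isoChartLin_ne_zero hμ₁ hμ₂ θ₀ n)).toContinuousLinearEquiv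

/-- The chart in coordinates. [folklore] -/
theorem isoChart_apply (θ₀ : ℝ) (n : ℕ) (t : MomSpace) :
    isoChart hμ₁ hμ₂ θ₀ n t = WithLp.toLp 2
      ![(4 : ℝ) ^ (-(n : ℤ)) * t 0,
        (4 : ℝ) ^ (-(n : ℤ)) * fermiNormal μ θ₀ 0 * t 1 + (4 : ℝ) ^ (-(n : ℤ)) * fermiTangent μ θ₀ 0 * t 2,
        (4 : ℝ) ^ (-(n : ℤ)) * fermiNormal μ θ₀ 1 * t 1 + (4 : ℝ) ^ (-(n : ℤ)) * fermiTangent μ θ₀ 1 * t 2] := by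
  change isoChartLin μ θ₀ n t = _
  rw [isoChartLin, Matrix.toEuclideanLin, Matrix.toLpLin_apply]
  congr 1
  funext i
  fin_cases i <;> simp [isoChartMatrix, Matrix.mulVec, dotProduct, Fin.sum_univ_three]

/-- Its determinant. [folklore] -/
theorem det_isoChart (θ₀ : ℝ) (n : ℕ) :
    LinearMap.det ((isoChart hμ₁ hμ₂ θ₀ n : MomSpace ≃ₗ[ℝ] MomSpace) : MomSpace →ₗ[ℝ] MomSpace) =
      (4 : ℝ) ^ (-(n : ℤ)) * (4 : ℝ) ^ (-(n : ℤ)) * (4 : ℝ) ^ (-(n : ℤ)) := by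
  rw [← det_isoChartLin hμ₁ hμ₂ θ₀ n]
  rfl

/-- The determinant of the inverse chart. [folklore] -/
theorem det_isoChart_symm (θ₀ : ℝ) (n : ℕ) :
    LinearMap.det (((isoChart hμ₁ hμ₂ θ₀ n).symm : MomSpace ≃ₗ[ℝ] MomSpace) : MomSpace →ₗ[ℝ] MomSpace) =
      ((4 : ℝ) ^ (-(n : ℤ)) * (4 : ℝ) ^ (-(n : ℤ)) * (4 : ℝ) ^ (-(n : ℤ)))⁻¹ := by
  rw [← det_isoChart hμ₁ hμ₂ θ₀ n]
  exact LinearEquiv.det_coe_symm _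

omit hμ₁ hμ₂ in
/-- **The adjoint of the isotropic chart**: `w ↦ 4^{-n}(w₀, ⟨n, w⃗⟩, ⟨τ, w⃗⟩)`. [cite: BenfattoGiulianiMastropietro2006, §2.5 (2.60)] -/
def isoChartAdj (μ θ₀ : ℝ) (n : ℕ) (w : MomSpace) : MomSpace :=
  WithLp.toLp 2
    ![(4 : ℝ) ^ (-(n : ℤ)) * w 0,
      (4 : ℝ) ^ (-(n : ℤ)) * (fermiNormal μ θ₀ 0 * w 1 + fermiNormal μ θ₀ 1 * w 2),
      (4 : ℝ) ^ (-(n : ℤ)) * (fermiTangent μ θ₀ 0 * w 1 + fermiTangent μ θ₀ 1 * w 2)]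

/-- `isoChartAdj` is the adjoint of `isoChart`. [folklore] -/
theorem adjoint_isoChart (θ₀ : ℝ) (n : ℕ) (w : MomSpace) :
    ContinuousLinearMap.adjoint (isoChart hμ₁ hμ₂ θ₀ n : MomSpace →L[ℝ] MomSpace) w = isoChartAdj μ θ₀ n w := by
  refine ext_inner_right ℝ fun t => ?_
  rw [ContinuousLinearMap.adjoint_inner_left, ContinuousLinearEquiv.coe_coe, isoChart_apply, inner_E3, inner_E3]
  simp only [isoChartAdj, PiLp.toLp_apply, Matrix.cons_val_zero, Matrix.cons_val_one, Matrix.cons_val_two,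
    Matrix.tail_cons, Matrix.head_cons]
  ring

end Chart

/-! ### The rescaled isotropic symbol and the decay transfer -/

section Transfer

variable {μ : ℝ} (hμ₁ : -4 < μ) (hμ₂ : μ < -2 - Real.sqrt 2)
include hμ₁ hμ₂

/-- The isotropic symbol on `ℝ³`. [cite: BenfattoGiulianiMastropietro2006, §2.5 (2.59)] -/
def isoSymbolE (e₀ μ : ℝ) (n : ℕ) (ω : ℤ) : MomSpace → ℂ := genSymbolE e₀ μ n (2 * n) ω

omit hμ₁ hμ₂ in
/-- The isotropic propagator as a Fourier transform. [cite: BenfattoGiulianiMastropietro2006, §2.5 (2.59)] -/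
theorem isoPropagator_eq_fourier (e₀ μ : ℝ) (n : ℕ) (ω : ℤ) (x₀ : ℝ) (x : Fin 2 → ℝ) :
    isoPropagator e₀ μ n ω x₀ x = 𝓕 (isoSymbolE e₀ μ n ω) (dualPoint x₀ x) :=
  genPropagator_eq_fourier e₀ μ n (2 * n) ω x₀ x

/-- **The rescaled isotropic symbol** `t ↦ isoSymbolE(q_F + isoChart t)` at `θ̄ = θ_{2n,ω̄}`. [cite: BenfattoGiulianiMastropietro2006, §2.5 (2.58)] -/
def rescaledIsoSymbol (e₀ : ℝ) (n : ℕ) (ω : ℤ) : MomSpace → ℂ := fun t =>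
  isoSymbolE e₀ μ n ω (fermiBasePoint μ (((ω : ℝ) + 1 / 2) * sectorWidth (2 * n)) +
    isoChart hμ₁ hμ₂ (((ω : ℝ) + 1 / 2) * sectorWidth (2 * n)) n t)

/-- The symbol is the rescaled symbol in the chart. [folklore] -/
theorem isoSymbolE_eq_comp (e₀ : ℝ) (n : ℕ) (ω : ℤ) :
    isoSymbolE e₀ μ n ω =
      (rescaledIsoSymbol hμ₁ hμ₂ e₀ n ω ∘ (isoChart hμ₁ hμ₂ (((ω : ℝ) + 1 / 2) * sectorWidth (2 * n)) n).symm) ∘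
        fun q => q + -fermiBasePoint μ (((ω : ℝ) + 1 / 2) * sectorWidth (2 * n)) := by
  funext q
  simp only [Function.comp_apply, rescaledIsoSymbol, ContinuousLinearEquiv.apply_symm_apply]
  congr 1
  abel

/-- **Isotropic decay transfer.** If `‖𝓕R̄(y)‖ ≤ K(1+‖y‖)^{-N}` then
`|ḡ^{(-n)}_ω̄(x₀, x⃗)| ≤ (4^{-n})³ · K · (1 + ‖isoChartAdj(ξ)‖)^{-N}` (`ξ` the dual point). With
`K = O(4ⁿ)` this is BGM (2.60): `C_N γ^{2h}/(1 + (γ^h|x₀| + γ^h|x⃗|))^N`. [cite: BenfattoGiulianiMastropietro2006, §2.5 Lemma 2.3 (2.60)] -/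
theorem norm_isoPropagator_le_of_fourier_decay {e₀ : ℝ} {n : ℕ} {ω : ℤ} {K : ℝ} {N : ℕ}
    (hK : ∀ y, ‖𝓕 (rescaledIsoSymbol hμ₁ hμ₂ e₀ n ω) y‖ ≤ K * ((1 + ‖y‖) ^ N)⁻¹)
    (x₀ : ℝ) (x : Fin 2 → ℝ) :
    ‖isoPropagator e₀ μ n ω x₀ x‖ ≤
      ((4 : ℝ) ^ (-(n : ℤ)) * (4 : ℝ) ^ (-(n : ℤ)) * (4 : ℝ) ^ (-(n : ℤ))) *
        (K * ((1 + ‖isoChartAdj μ (((ω : ℝ) + 1 / 2) * sectorWidth (2 * n)) n (dualPoint x₀ x)‖) ^ N)⁻¹) := by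
  set θ₀ : ℝ := ((ω : ℝ) + 1 / 2) * sectorWidth (2 * n) with hθ₀
  set A := isoChart hμ₁ hμ₂ θ₀ n with hA
  rw [isoPropagator_eq_fourier, isoSymbolE_eq_comp hμ₁ hμ₂, norm_fourier_comp_add_right]
  have h := Literature.Analysis.Fourier.norm_fourier_comp_continuousLinearEquiv_le A.symm hK (dualPoint x₀ x)
  rw [ContinuousLinearEquiv.symm_symm, adjoint_isoChart hμ₁ hμ₂] at h
  refine h.trans (le_of_eq ?_)
  have hdet := det_isoChart_symm hμ₁ hμ₂ θ₀ n
  rw [← hA] at hdet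
  have hpos : 0 < (4 : ℝ) ^ (-(n : ℤ)) * (4 : ℝ) ^ (-(n : ℤ)) * (4 : ℝ) ^ (-(n : ℤ)) := by positivity
  have key : |(LinearMap.det ((A.symm : MomSpace ≃ₗ[ℝ] MomSpace) : MomSpace →ₗ[ℝ] MomSpace))⁻¹| =
      (4 : ℝ) ^ (-(n : ℤ)) * (4 : ℝ) ^ (-(n : ℤ)) * (4 : ℝ) ^ (-(n : ℤ)) := by
    rw [hdet, inv_inv, abs_of_pos hpos]
  exact congrArg₂ (· * ·) key rfl

end Transfer

end Literature.MathematicalPhysics.QuantumLattice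

end
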